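import Literature.NumberTheory.LFunctions.KMVSecondMomentBandSqueeze
import HarnessLib

/-!
# Converse for the census of line `prime-averaged-squeeze`: in a world with level-free tables, the
averaged diagonal-only second-moment display at `(P, Q, Δ')` is EXACTLY `T₂ Δ' P Q = 0`
(Kowalski–Michel–VanderKam 2000, §6 p. 19)

Topic `Literature/NumberTheory/LFunctions` (cell landau-siegel §D, crux K_B stmt-Parity-20343). PROVED,
0 named facts, no Petersson input. `KMVPrimeAveragedSecondSqueeze` (p531103) shows: the second defect
`o(1)` on average over the good primes of dyadic blocks ⇒ `T₂ = 0` (under `MomentAsymptotics`). This file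
proves the converse — under `MomentAsymptotics` with `T₂ Δ' P Q = 0` the second defect is pointwise
`O(1/log q̂)` at the good primes, hence `o(1)` on average — so that, GIVEN the tables K_B quantifies over,
the registered stub A of the line costs exactly «the true second off-diagonal main term vanishes at `X²`
just beyond the diagonal», while the value crux itself needs only `T₂ < 4(Δ'−1)/Δ'` there (and the
band form of `KMVSecondMomentBandSqueeze` needs only `0 < second + T₂ < 2·lin²`). Bookkeeping for the
planner's census; nothing here is an input of the line.

* `secondDefect_le_abs_T₂_add` — upper twin of `abs_T₂_sub_le_secondDefect` (p523798):
  `secondDefect ≤ |T₂| + C/log q̂` at good primes past a threshold.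
* `secondDefect_average_of_T₂_eq_zero` — `T₂ Δ' P Q = 0` ⇒ the averaged display at `(P, Q, Δ')`.

«The programme SEARCHES and TYPES; no claim about Landau–Siegel zeros, Theorems 1–2 of
arXiv:2211.02515 or a repaired Margin232 until a kernel theorem says so.»

## References

* [KowalskiMichelVanderKam2000] J. reine angew. Math. 526 (2000) 1–34: §6 p. 19 (second-moment
  display), §2 p. 7 (`M ∉ ℤ`). [held: paper:doi-10-1515-crll-2000-074 p0007, p0019]
-/

noncomputable section

namespace Literature.NumberTheory.LFunctions.KMV2000

open Polynomial Finset
open scoped _root_.Real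

variable {q : ℕ} [NeZero q]

/-- **Upper twin of `abs_T₂_sub_le_secondDefect`.** Under `MomentAsymptotics Δlo Δhi T₁ T₂`, at every
good prime past a threshold the second defect is `≤ |T₂ Δ' P Q| + C/log q̂(q)` (and `B ≤ log q̂(q)` for any
prescribed `B ≥ 1`). [cite: KowalskiMichelVanderKam2000, §6 p. 19 (second-moment display)] -/
theorem secondDefect_le_abs_T₂_add {Δlo Δhi : ℝ} {T₁ T₂ : ℝ → ℝ[X] → ℝ[X] → ℝ}
    (h : MomentAsymptotics Δlo Δhi T₁ T₂) {P Q : ℝ[X]} (hP : Admissible P) (hQ : IsEvenOrOdd Q)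
    {Δ' : ℝ} (h1 : Δlo < Δ') (h2 : Δ' ≤ Δhi) (hΔ' : 0 < Δ') {B : ℝ} (hB : 1 ≤ B) :
    ∃ C : ℝ, 0 ≤ C ∧ ∃ q₀ : ℕ, ∀ (q : ℕ) [NeZero q], q.Prime → q₀ ≤ q →
      (∀ n : ℕ, (n : ℝ) ≠ qhat q ^ Δ') →
        B ≤ Real.log (qhat q) ∧ secondDefect P Q Δ' q ≤ |T₂ Δ' P Q| + C / Real.log (qhat q) := by
  obtain ⟨C, q₀, hC⟩ := h P Q hP hQ Δ' h1 h2
  obtain ⟨N, hN⟩ := exists_log_qhat_ge B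
  set α : ℝ := π ^ 2 / 6 with hα_def
  have hα : 0 < α := by positivity
  refine ⟨|C| * Δ' ^ 2 / (2 * α ^ 2), by positivity, max q₀ (max N 40), fun q _ hq hq₀ hgood ↦ ?_⟩
  have hq₀' : q₀ ≤ q := le_trans (le_max_left _ _) hq₀
  have hqN : N ≤ q := le_trans (le_trans (le_max_left _ _) (le_max_right _ _)) hq₀
  have hq40 : 40 ≤ q := le_trans (le_trans (le_max_right _ _) (le_max_right _ _)) hq₀
  have hlg : B ≤ Real.log (qhat q) := hN q hqN
  have hlgpos : 0 < Real.log (qhat q) := by linarith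
  have hqhatpos : 0 < qhat q := lt_trans one_pos (one_lt_qhat hq40)
  refine ⟨hlg, ?_⟩
  obtain ⟨-, b2⟩ := hC q hq hq₀' hgood
  set m : ℝ := 2 * α ^ 2 * (qhat q / (Δ' ^ 2 * Real.log (qhat q) ^ 2)) with hm_def
  have hm : 0 < m := by positivity
  have hms : mainScale q Δ' = ((m : ℝ) : ℂ) := by
    rw [mainScale_eq_ofReal, hm_def, hα_def]
  have hS : (2 * riemannZeta 2 ^ 2 * ((qhat q / (Δ' ^ 2 * Real.log (qhat q) ^ 2) : ℝ) : ℂ)) =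
      ((m : ℝ) : ℂ) := by
    rw [riemannZeta_two, hm_def, hα_def]; push_cast; ring
  rw [hS] at b2
  -- secondDefect = ‖Qh − m·second‖/m ≤ (‖Qh − m(second+T₂)‖ + m|T₂|)/m
  have hsd : secondDefect P Q Δ' q =
      ‖QhPQ q P Q (qhat q ^ Δ') - ((m : ℝ) : ℂ) * ((secondMomentForm Δ' P Q : ℝ) : ℂ)‖ / m := by
    unfold secondDefect
    rw [dif_neg (NeZero.ne q), hms, Complex.norm_real, Real.norm_eq_abs, abs_of_pos hm]
  have hdec : QhPQ q P Q (qhat q ^ Δ') - ((m : ℝ) : ℂ) * ((secondMomentForm Δ' P Q : ℝ) : ℂ) =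
      (QhPQ q P Q (qhat q ^ Δ') -
          ((m : ℝ) : ℂ) * ((secondMomentForm Δ' P Q + T₂ Δ' P Q : ℝ) : ℂ)) +
        ((m * T₂ Δ' P Q : ℝ) : ℂ) := by
    push_cast; ring
  have htri : ‖QhPQ q P Q (qhat q ^ Δ') - ((m : ℝ) : ℂ) * ((secondMomentForm Δ' P Q : ℝ) : ℂ)‖ ≤
      |C| * qhat q * (Real.log (qhat q))⁻¹ ^ 3 + m * |T₂ Δ' P Q| := by
    rw [hdec]
    refine (norm_add_le _ _).trans (add_le_add (b2.trans ?_) (le_of_eq ?_))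
    · have hs : 0 ≤ qhat q * (Real.log (qhat q))⁻¹ ^ 3 := by positivity
      rw [mul_assoc, mul_assoc]
      exact mul_le_mul_of_nonneg_right (le_abs_self C) hs
    · rw [Complex.norm_real, Real.norm_eq_abs, abs_mul, abs_of_pos hm]
  have e₂ : (|C| * qhat q * (Real.log (qhat q))⁻¹ ^ 3 + m * |T₂ Δ' P Q|) / m =
      |T₂ Δ' P Q| + |C| * Δ' ^ 2 / (2 * α ^ 2) / Real.log (qhat q) := by
    rw [hm_def]; field_simp; ring
  rw [hsd, ← e₂]
  exact div_le_div_of_nonneg_right htri hm.le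

/-- **Converse (census): in an MA-world `T₂ = 0` gives the averaged display.** If the moment
asymptotics hold on `(Δlo, Δhi]` with `T₂ Δ' P Q = 0` at some `Δ' ∈ (Δlo, Δhi]`, `Δ' > 0`, then the second
defect at `(P, Q, Δ')` is `o(1)` on average over the good primes of dyadic blocks (indeed pointwise
`O(1/log q̂)`). With `T₂_eq_zero_of_secondDefect_average`: GIVEN the tables, the averaged diagonal-only
display at `(P, Q, Δ')` is EQUIVALENT to `T₂ Δ' P Q = 0` — the registered stub of line
`prime-averaged-squeeze` costs exactly the vanishing of the true second off-diagonal main term at `X²` just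
beyond the diagonal (the value crux needs only `T₂ < 4(Δ'−1)/Δ'` there).
[cite: KowalskiMichelVanderKam2000, §6 p. 19 (second-moment display)] -/
theorem secondDefect_average_of_T₂_eq_zero {Δlo Δhi : ℝ} {T₁ T₂ : ℝ → ℝ[X] → ℝ[X] → ℝ}
    (h : MomentAsymptotics Δlo Δhi T₁ T₂) {P Q : ℝ[X]} (hP : Admissible P) (hQ : IsEvenOrOdd Q)
    {Δ' : ℝ} (h1 : Δlo < Δ') (h2 : Δ' ≤ Δhi) (hΔ' : 0 < Δ') (hT₂ : T₂ Δ' P Q = 0) :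
    ∀ ε : ℝ, 0 < ε → ∃ N₀ : ℕ, ∀ N : ℕ, N₀ ≤ N →
      ∑ q ∈ goodPrimes Δ' N, secondDefect P Q Δ' q ≤ ε * (goodPrimes Δ' N).card := by
  intro ε hε
  -- with `B = max 1 (C/ε)`... we do not know `C` before choosing `B`; take `B = 1` first to get `C`,
  -- then re-invoke with `B = max 1 (C/ε)`: the constant `C` does not depend on `B`.
  obtain ⟨C, hC0, q₀, hC⟩ := secondDefect_le_abs_T₂_add h hP hQ h1 h2 hΔ' (le_max_left 1 (0 : ℝ))
  obtain ⟨N₁, hN₁⟩ := exists_log_qhat_ge (C / ε + 1)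
  refine ⟨max q₀ N₁, fun N hN ↦ ?_⟩
  have hterm : ∀ q ∈ goodPrimes Δ' N, secondDefect P Q Δ' q ≤ ε := by
    intro q hq
    rw [mem_goodPrimes_iff] at hq
    obtain ⟨hqN, -, hqp, hqg⟩ := hq
    haveI : NeZero q := ⟨hqp.ne_zero⟩
    have hq₀ : q₀ ≤ q := by have := le_trans (le_max_left _ _) hN; omega
    have hqN₁ : N₁ ≤ q := by have := le_trans (le_max_right _ _) hN; omega
    obtain ⟨hlg1, hle⟩ := hC q hqp hq₀ (fun n ↦ by simpa [qhat] using hqg n)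
    have hlgB : C / ε + 1 ≤ Real.log (qhat q) := hN₁ q hqN₁
    have hlgpos : 0 < Real.log (qhat q) := by
      have : (1 : ℝ) ≤ max 1 0 := le_max_left _ _
      linarith
    rw [hT₂, abs_zero, zero_add] at hle
    refine hle.trans ?_
    rw [div_le_iff₀ hlgpos]
    have e : C / ε * ε = C := div_mul_cancel₀ _ hε.ne'
    nlinarith [mul_le_mul_of_nonneg_left hlgB hε.le]
  have := Finset.sum_le_sum hterm
  rwa [Finset.sum_const, nsmul_eq_mul, mul_comm] at this

end Literature.NumberTheory.LFunctions.KMV2000
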